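import Mathlib
import Summits.Ventures.PercRepro2.TypedSepThreeStates

/-!
# The typed (SEP-3) zero, I′: sorting the side states and the vanishing on all valid triples
(blind cell PercRepro2, p3 g6, 2026-08-25; `proofs/P3-BRIDGE.md` §11.20)

`dsym` is invariant under permuting the o-states and under permuting the b-states
(`TypedSepThreeStates.lean`), so its value on any valid ordered pair of triples is its value on
the sorted representatives (`sort3O`, `sort3B`), where it vanishes (`dsym_zero_all`): hence
**`dsym_eq_zero`** on every valid ordered pair of triples.  Own work; standard axioms.
-/

namespace Summit.Ventures.PercRepro2

namespace CovForm

namespace SepThree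

open OneTyped

/-- Sort three o-states by their code (an explicit sorting network). -/
def sort3O (x y w : OSt) : OSt × OSt × OSt :=
  if codeO x ≤ codeO y then
    (if codeO y ≤ codeO w then (x, y, w) else if codeO x ≤ codeO w then (x, w, y) else (w, x, y))
  else
    (if codeO x ≤ codeO w then (y, x, w) else if codeO y ≤ codeO w then (y, w, x) else (w, y, x))

/-- Sort three b-states by their code (an explicit sorting network). -/
def sort3B (u v r : BSt) : BSt × BSt × BSt :=
  if codeB u ≤ codeB v then
    (if codeB v ≤ codeB r then (u, v, r) else if codeB u ≤ codeB r then (u, r, v) else (r, u, v))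
  else
    (if codeB u ≤ codeB r then (v, u, r) else if codeB v ≤ codeB r then (v, r, u) else (r, v, u))

/-- `dsym` is unchanged by sorting the o-states. -/
lemma dsym_sort3O (x y w : OSt) (u v r : BSt) :
    dsym x y w u v r = dsym (sort3O x y w).1 (sort3O x y w).2.1 (sort3O x y w).2.2 u v r := by
  unfold sort3O
  split_ifs <;> dsimp only <;>
    first
    | rfl
    | exact dsym_swapO12 x y w u v r
    | exact dsym_swapO23 x y w u v r
    | exact (dsym_swapO12 x y w u v r).trans (dsym_swapO23 y x w u v r)
    | exact (dsym_swapO23 x y w u v r).trans (dsym_swapO12 x w y u v r)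
    | exact ((dsym_swapO12 x y w u v r).trans (dsym_swapO23 y x w u v r)).trans
        (dsym_swapO12 y w x u v r)

/-- `dsym` is unchanged by sorting the b-states. -/
lemma dsym_sort3B (x y w : OSt) (u v r : BSt) :
    dsym x y w u v r = dsym x y w (sort3B u v r).1 (sort3B u v r).2.1 (sort3B u v r).2.2 := by
  unfold sort3B
  split_ifs <;> dsimp only <;>
    first
    | rfl
    | exact dsym_swapB12 x y w u v r
    | exact dsym_swapB23 x y w u v r
    | exact (dsym_swapB12 x y w u v r).trans (dsym_swapB23 x y w v u r)
    | exact (dsym_swapB23 x y w u v r).trans (dsym_swapB12 x y w u r v)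
    | exact ((dsym_swapB12 x y w u v r).trans (dsym_swapB23 x y w v u r)).trans
        (dsym_swapB12 x y w v r u)

/-- Sorting a valid o-triple lands in the list. -/
theorem sort3O_mem (x y w : OSt) (hx : ValidO x = true) (hy : ValidO y = true)
    (hw : ValidO w = true) : sort3O x y w ∈ oTriples := by
  have hx' := mem_oList x hx
  have hy' := mem_oList y hy
  have hw' := mem_oList w hw
  unfold sort3O
  split_ifs <;> rw [mem_oTriples] <;> refine ⟨⟨?_, ?_, ?_⟩, ?_, ?_⟩ <;> first | assumption | omega

/-- Sorting a valid b-triple lands in the list. -/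
theorem sort3B_mem (u v r : BSt) (hu : ValidB u = true) (hv : ValidB v = true)
    (hr : ValidB r = true) : sort3B u v r ∈ bTriples := by
  have hu' := mem_bList u hu
  have hv' := mem_bList v hv
  have hr' := mem_bList r hr
  unfold sort3B
  split_ifs <;> rw [mem_bTriples] <;> refine ⟨⟨?_, ?_, ?_⟩, ?_, ?_⟩ <;> first | assumption | omega

/-- **The doubly symmetrised kernel vanishes on every sorted pair of valid triples.** -/
theorem dsym_zero_sorted : ∀ s ∈ oTriples, ∀ t ∈ bTriples,
    dsym s.1 s.2.1 s.2.2 t.1 t.2.1 t.2.2 = 0 := by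
  rintro ⟨x, y, w⟩ hs ⟨u, v, r⟩ ht
  rw [mem_oTriples] at hs
  rw [mem_bTriples] at ht
  have key := dsym_zero_all
  simp only [List.all_eq_true] at key
  have h := key (x, y, w) (mem_oTriples.2 hs)
  simp only [allZeroAt, bSorted, List.all_eq_true, decide_eq_true_eq, List.mem_filter] at h
  exact h u ht.1.1 v ⟨ht.1.2.1, ht.2.1⟩ r ⟨ht.1.2.2, ht.2.2⟩

/-- **THE DOUBLY SYMMETRISED KERNEL VANISHES IDENTICALLY on valid states.** -/
theorem dsym_eq_zero (x y w : OSt) (u v r : BSt) (hx : ValidO x = true) (hy : ValidO y = true)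
    (hw : ValidO w = true) (hu : ValidB u = true) (hv : ValidB v = true) (hr : ValidB r = true) :
    dsym x y w u v r = 0 := by
  rw [dsym_sort3O, dsym_sort3B]
  exact dsym_zero_sorted _ (sort3O_mem x y w hx hy hw) _ (sort3B_mem u v r hu hv hr)

end SepThree

end CovForm

end Summit.Ventures.PercRepro2
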